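import Summits.QuantumFields.YangMills.Theorems.PoincareLipschitzLogCutoffLetters
import Literature.MathematicalPhysics.QuantumFieldTheory.GawedzkiKupiainen1985.BubbleLogLowerBound
import HarnessLib

/-!
# Crux `HistoryTailL` (stmt-QuantumFields-19936), K2 organ `hImproveCore` ∕ `hImproveCoreFlat` (FROZEN v1 7446c95a ∕ bac8eda3):
# THE SUP-NORM LOG-PROFILE CAPACITY ON `ℤ³` (`≤ 6r(H+2) + 96r`, `H = Σ 1∕(k+1) ≈ log(M∕r)`), ABEL SUMMATION OF THE WEIGHTED ENERGY,
# AND THE HARMONIC ∕ LOGARITHM LETTERS — the finite-sum half of the Schoen–Uhlenbeck log-cutoff test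

Cell `ym3-torus` (YM ladder rung R3 = continuum SU(2) Yang–Mills on the three-torus — a RUNG, NOT the Clay problem: not d = 4, not infinite
volume, not a mass gap), WIDTH seat `ym-ust-19936-w3` gen 14; `--supports stmt-QuantumFields-19936 --as helper`; THEOREMS ONLY, definition-free.
Imports ✓`…LogCutoffLetters` (shell index, face count, log profile) and lit ✓`GawedzkiKupiainen1985.BubbleLogLowerBound` (for the landed
`log_div_le_sum_Ico_inv : log((R+1)∕(m+1)) ≤ Σ_{[m,R)} 1∕(r+1)`; telescoping by Mathlib's `Finset.sum_Ico_sub`).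

WHY.  With the profile `η = f∘N` of ✓`exists_logProfile` the stability inequality's gradient side is a lattice CAPACITY: each shell crossing
`k ↔ k+1` carries `≤ 6(2k+1)²` bonds (✓`card_crossing_le`) times the Hardy increment `r∕(4k²(k+1))` on the log range (`≤ 6r·(1∕(k+1) + 2(1∕k − 1∕(k+1)))`
bond by bond), `r∕M³` on the taper; summed: `Σ_{bonds ⊂ Q_{2M}} (η_x − η_y)² ≤ 6r(H + 2) + 96r` — the cube twin of `∫|∇|x|^{−1∕2}|² = π log` (round
shells: `4π·¼`; cube shells: `24·¼ = 6`).  The energy side is ABEL-summed: `Σ_b η_xη_y e_b ≥ Σ_{k∈[r,M)} (r∕k − r∕(k+1))·E_k`, `E_k` the energy of the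
bonds with both ends in `Q_k(z)` (partial telescoping below the larger shell index of the bond).  §3: the
window letter `2e^{H₀}r ≤ M ⇒ H ≥ H₀`, and the closing arithmetic of the cap.  Consumer: ✓∕⧗`…LogCutoffStabilityCap.exists_scale_energy_le`.

WHAT (ns `…Theorems.PoincareLipschitzLogCutoffCapacity`).
* §1 `face_mul_hardy_le`, ★★`sum_sq_sub_profile_le` (the capacity).
* §2 `sum_ite_sq_sub_sq_le`, ★`sum_box_energy_le_sum_profile` (Abel lower bound).
* §3 `le_harmonic_of_window` (over lit ✓`GawedzkiKupiainen1985.log_div_le_sum_Ico_inv`), `cap_arith`.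
HONEST SCOPE.  Finite sums and one-variable real analysis; nothing of `hImproveCore(Flat)`, `hImprove`, K1-exp, `MeanDeviationL`, `BlockLipschitzL`,
`HistoryTailL` or any summit statement is proved.  YM₃ on T³ is rung R3, NOT the Clay problem.

References: R. Schoen, K. Uhlenbeck, Invent. Math. **78** (1984) 89–100 [SchoenUhlenbeck1984] §2; Y. L. Xin, Duke Math. J. **47** (1980) 609–613 [Xin1980];
M. Giaquinta [Giaquinta1984] Ch. III §2 p.77 (cutoff bookkeeping).
-/

set_option autoImplicit false

open scoped BigOperators
open Finset Matrix

namespace Summit.QuantumFields.YangMills.Theorems.PoincareLipschitzLogCutoffCapacity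

open Literature.MathematicalPhysics.QuantumFieldTheory.Balaban1983to89.B4Eq19LatticeOperators
  (Zd unitVec box mem_box box_mono card_box add_unitVec_mem_box sub_unitVec_mem_box unitVec_apply_self unitVec_apply_ne)
open Summit.QuantumFields.YangMills.Theorems.PoincareLipschitzLogCutoffLetters (supIndex_step card_crossing_le)
open Literature.MathematicalPhysics.QuantumFieldTheory.GawedzkiKupiainen1985 (log_div_le_sum_Ico_inv)

/-! ## §1 The log-profile capacity on `ℤ³` -/

/-- The arithmetic of the Hardy increments against the face count: `6(2k+1)²·r∕(4k²(k+1)) ≤ 6r·(1∕(k+1) + 2(1∕k − 1∕(k+1)))` (`k ≥ 1`). [folklore] -/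
theorem face_mul_hardy_le {r k : ℕ} (hk : 1 ≤ k) :
    (6 * (2 * (k : ℝ) + 1) ^ 2) * ((r : ℝ) / (4 * (k : ℝ) ^ 2 * (k + 1))) ≤
      6 * (r : ℝ) * (1 / ((k : ℝ) + 1) + 2 * (1 / (k : ℝ) - 1 / ((k : ℝ) + 1))) := by
  have hk0 : (1 : ℝ) ≤ k := by exact_mod_cast hk
  have hkey : (2 * (k : ℝ) + 1) ^ 2 / (4 * (k : ℝ) ^ 2 * (k + 1)) ≤ 1 / ((k : ℝ) + 1) + 2 * (1 / (k : ℝ) - 1 / ((k : ℝ) + 1)) := by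
    have h2 : 1 / ((k : ℝ) + 1) + 2 * (1 / (k : ℝ) - 1 / ((k : ℝ) + 1)) = ((k : ℝ) + 2) / ((k : ℝ) * (k + 1)) := by
      field_simp
      ring
    rw [h2, div_le_div_iff₀ (by positivity) (by positivity)]
    nlinarith [hk0, sq_nonneg (k : ℝ), mul_pos (show (0:ℝ) < k by linarith) (show (0:ℝ) < k + 1 by linarith)]
  calc (6 * (2 * (k : ℝ) + 1) ^ 2) * ((r : ℝ) / (4 * (k : ℝ) ^ 2 * (k + 1)))
      = 6 * (r : ℝ) * ((2 * (k : ℝ) + 1) ^ 2 / (4 * (k : ℝ) ^ 2 * (k + 1))) := by ring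
    _ ≤ 6 * (r : ℝ) * (1 / ((k : ℝ) + 1) + 2 * (1 / (k : ℝ) - 1 / ((k : ℝ) + 1))) :=
        mul_le_mul_of_nonneg_left hkey (by positivity)

/-- ★★ **THE SUP-NORM LOG-PROFILE CAPACITY ON `ℤ³`.**  For the shell index `N` of `Q_•(z)` and a profile `f` as in ✓`exists_logProfile`
(`1 ≤ r ≤ M`), the lattice Dirichlet energy of `η = f ∘ N` over the bonds issuing from `Q_{2M}(z)` is at most
`6r·(H + 2) + 96r`, `H = Σ_{k ∈ [r,M)} 1∕(k+1)` (`≈ log(M∕r)`): the face count `6(2k+1)²` (✓`card_crossing_le`) against the Hardy increments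
`r∕(4k²(k+1))` on the log range and `r∕M³` on the taper — the cube twin of `∫|∇|x|^{−1∕2}|² = π·log` (round `4π·¼`; cube `24·¼ = 6`). [folklore] -/
theorem sum_sq_sub_profile_le (z : Zd 3) {N : Zd 3 → ℕ} (hN : ∀ (y : Zd 3) (k : ℕ), y ∈ box z (k : ℤ) ↔ N y ≤ k)
    {r M : ℕ} (hr : 1 ≤ r) (hrM : r ≤ M) {f : ℕ → ℝ}
    (hzero : ∀ n, 2 * M ≤ n → f n = 0) (hone : ∀ n, n ≤ r → f n = 1)
    (hlogInc : ∀ k, r ≤ k → k < M → (f k - f (k + 1)) ^ 2 ≤ (r : ℝ) / (4 * (k : ℝ) ^ 2 * (k + 1)))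
    (htapInc : ∀ k, M ≤ k → k < 2 * M → (f k - f (k + 1)) ^ 2 ≤ (r : ℝ) / (M : ℝ) ^ 3) :
    ∑ b ∈ (box z (2 * (M : ℤ))) ×ˢ (Finset.univ : Finset (Fin 3)), (f (N b.1) - f (N (b.1 + unitVec b.2))) ^ 2 ≤
      6 * (r : ℝ) * (∑ k ∈ Finset.Ico r M, 1 / ((k : ℝ) + 1) + 2) + 96 * r := by
  classical
  have hr0 : (0 : ℝ) < r := by exact_mod_cast hr
  have hM0 : (0 : ℝ) < M := by exact_mod_cast (lt_of_lt_of_le hr hrM)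
  have hM1 : 1 ≤ M := le_trans hr hrM
  set A := (box z (2 * (M : ℤ))) ×ˢ (Finset.univ : Finset (Fin 3)) with hA
  set g : ℕ → ℝ := fun k => (f k - f (k + 1)) ^ 2 with hg
  have hg0 : ∀ k, 0 ≤ g k := fun k => sq_nonneg _
  set cr : ℕ → Zd 3 × Fin 3 → Prop := fun k b =>
    (b.1 ∈ box z (k : ℤ) ∧ b.1 + unitVec b.2 ∉ box z (k : ℤ)) ∨ (b.1 ∉ box z (k : ℤ) ∧ b.1 + unitVec b.2 ∈ box z (k : ℤ)) with hcr
  -- Step 1: pointwise domination by the crossing sums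
  have hpt : ∀ b : Zd 3 × Fin 3, (f (N b.1) - f (N (b.1 + unitVec b.2))) ^ 2 ≤
      ∑ k ∈ Finset.range (2 * M), if cr k b then g k else 0 := by
    intro b
    have hsum0 : 0 ≤ ∑ k ∈ Finset.range (2 * M), if cr k b then g k else 0 :=
      Finset.sum_nonneg fun k _ => by split_ifs <;> [exact hg0 k; exact le_rfl]
    have hterm : ∀ k, k < 2 * M → cr k b → g k ≤ ∑ k ∈ Finset.range (2 * M), if cr k b then g k else 0 := by
      intro k hk hck
      have := Finset.single_le_sum (f := fun k => if cr k b then g k else 0)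
        (fun i _ => by split_ifs <;> [exact hg0 i; exact le_rfl]) (Finset.mem_range.2 hk)
      simpa only [if_pos hck] using this
    obtain ⟨h1, h2⟩ := supIndex_step hN b.1 b.2
    rcases Nat.lt_trichotomy (N b.1) (N (b.1 + unitVec b.2)) with hlt | heq | hgt
    · -- forward crossing: `N(y+e) = N y + 1`
      have hx : N (b.1 + unitVec b.2) = N b.1 + 1 := by omega
      have hcrk : cr (N b.1) b := Or.inl ⟨(hN _ _).2 le_rfl, fun h => by have := (hN _ _).1 h; omega⟩
      by_cases hk : N b.1 < 2 * M
      · rw [hx]; exact hterm _ hk hcrk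
      · rw [hzero _ (by omega), hzero _ (by omega), sub_zero, zero_pow two_ne_zero]; exact hsum0
    · rw [heq, sub_self, zero_pow two_ne_zero]; exact hsum0
    · -- backward crossing: `N y = N(y+e) + 1`
      have hx : N b.1 = N (b.1 + unitVec b.2) + 1 := by omega
      have hcrk : cr (N (b.1 + unitVec b.2)) b :=
        Or.inr ⟨fun h => by have := (hN _ _).1 h; omega, (hN _ _).2 le_rfl⟩
      by_cases hk : N (b.1 + unitVec b.2) < 2 * M
      · have : (f (N b.1) - f (N (b.1 + unitVec b.2))) ^ 2 = g (N (b.1 + unitVec b.2)) := by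
          simp only [hg]; rw [← hx]; ring
        rw [this]; exact hterm _ hk hcrk
      · rw [hzero _ (by omega), hzero _ (by omega), sub_zero, zero_pow two_ne_zero]; exact hsum0
  -- Step 2: sum over the bonds, exchange, count the crossing bonds shell by shell
  have hcount : ∀ k, ((A.filter (cr k)).card : ℝ) ≤ 6 * (2 * (k : ℝ) + 1) ^ 2 := by
    intro k
    have hsub : A.filter (cr k) ⊆ ((box z ((k : ℤ) + 1)) ×ˢ (Finset.univ : Finset (Fin 3))).filter (cr k) := by
      intro b hb
      rw [Finset.mem_filter] at hb ⊢
      refine ⟨Finset.mem_product.2 ⟨?_, Finset.mem_univ _⟩, hb.2⟩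
      rcases hb.2 with ⟨h, _⟩ | ⟨_, h⟩
      · exact box_mono z (by linarith) h
      · have := sub_unitVec_mem_box h b.2
        rwa [add_sub_cancel_right] at this
    have h1 := (Finset.card_le_card hsub).trans (card_crossing_le z k)
    exact_mod_cast h1
  have hstep2 : ∑ b ∈ A, (f (N b.1) - f (N (b.1 + unitVec b.2))) ^ 2 ≤
      ∑ k ∈ Finset.range (2 * M), g k * (6 * (2 * (k : ℝ) + 1) ^ 2) := by
    calc ∑ b ∈ A, (f (N b.1) - f (N (b.1 + unitVec b.2))) ^ 2
        ≤ ∑ b ∈ A, ∑ k ∈ Finset.range (2 * M), (if cr k b then g k else 0) := Finset.sum_le_sum fun b _ => hpt b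
      _ = ∑ k ∈ Finset.range (2 * M), ∑ b ∈ A, (if cr k b then g k else 0) := Finset.sum_comm
      _ = ∑ k ∈ Finset.range (2 * M), g k * ((A.filter (cr k)).card : ℝ) := by
          refine Finset.sum_congr rfl fun k _ => ?_
          rw [← Finset.sum_filter, Finset.sum_const, nsmul_eq_mul, mul_comm]
      _ ≤ ∑ k ∈ Finset.range (2 * M), g k * (6 * (2 * (k : ℝ) + 1) ^ 2) :=
          Finset.sum_le_sum fun k _ => mul_le_mul_of_nonneg_left (hcount k) (hg0 k)
  -- Step 3: the three ranges
  have hsplit : ∑ k ∈ Finset.range (2 * M), g k * (6 * (2 * (k : ℝ) + 1) ^ 2) =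
      ∑ k ∈ Finset.Ico 0 r, g k * (6 * (2 * (k : ℝ) + 1) ^ 2) + ∑ k ∈ Finset.Ico r M, g k * (6 * (2 * (k : ℝ) + 1) ^ 2) +
        ∑ k ∈ Finset.Ico M (2 * M), g k * (6 * (2 * (k : ℝ) + 1) ^ 2) := by
    rw [Finset.range_eq_Ico, Finset.sum_Ico_consecutive _ (Nat.zero_le r) hrM,
      Finset.sum_Ico_consecutive _ (Nat.zero_le M) (by omega)]
  have hlow : ∑ k ∈ Finset.Ico 0 r, g k * (6 * (2 * (k : ℝ) + 1) ^ 2) = 0 := by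
    refine Finset.sum_eq_zero fun k hk => ?_
    rw [Finset.mem_Ico] at hk
    simp only [hg]
    rw [hone k hk.2.le, hone (k + 1) (by omega), sub_self, zero_pow two_ne_zero, zero_mul]
  have hmid : ∑ k ∈ Finset.Ico r M, g k * (6 * (2 * (k : ℝ) + 1) ^ 2) ≤
      6 * (r : ℝ) * (∑ k ∈ Finset.Ico r M, 1 / ((k : ℝ) + 1) + 2) := by
    calc ∑ k ∈ Finset.Ico r M, g k * (6 * (2 * (k : ℝ) + 1) ^ 2)
        ≤ ∑ k ∈ Finset.Ico r M, 6 * (r : ℝ) * (1 / ((k : ℝ) + 1) + 2 * (1 / (k : ℝ) - 1 / ((k : ℝ) + 1))) := by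
          refine Finset.sum_le_sum fun k hk => ?_
          rw [Finset.mem_Ico] at hk
          calc g k * (6 * (2 * (k : ℝ) + 1) ^ 2) ≤ ((r : ℝ) / (4 * (k : ℝ) ^ 2 * (k + 1))) * (6 * (2 * (k : ℝ) + 1) ^ 2) :=
                mul_le_mul_of_nonneg_right (hlogInc k hk.1 hk.2) (by positivity)
            _ = (6 * (2 * (k : ℝ) + 1) ^ 2) * ((r : ℝ) / (4 * (k : ℝ) ^ 2 * (k + 1))) := mul_comm _ _
            _ ≤ _ := face_mul_hardy_le (le_trans hr hk.1)
      _ = 6 * (r : ℝ) * (∑ k ∈ Finset.Ico r M, 1 / ((k : ℝ) + 1) +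
            2 * ∑ k ∈ Finset.Ico r M, (1 / (k : ℝ) - 1 / ((k : ℝ) + 1))) := by
          rw [← Finset.mul_sum, Finset.sum_add_distrib, Finset.mul_sum]
      _ ≤ 6 * (r : ℝ) * (∑ k ∈ Finset.Ico r M, 1 / ((k : ℝ) + 1) + 2) := by
          have htel : ∑ k ∈ Finset.Ico r M, (1 / (k : ℝ) - 1 / ((k : ℝ) + 1)) = 1 / (r : ℝ) - 1 / (M : ℝ) := by
            have h := Finset.sum_Ico_sub (f := fun k : ℕ => -(1 / (k : ℝ))) hrM
            simp only [Nat.cast_add, Nat.cast_one] at h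
            rw [show (1 : ℝ) / r - 1 / M = -(1 / (M : ℝ)) - -(1 / (r : ℝ)) by ring, ← h]
            exact Finset.sum_congr rfl fun k _ => by ring
          rw [htel]
          have h1 : 1 / (r : ℝ) ≤ 1 := by rw [div_le_one hr0]; exact_mod_cast hr
          have h2 : 0 ≤ 1 / (M : ℝ) := by positivity
          nlinarith [hr0]
  have hhigh : ∑ k ∈ Finset.Ico M (2 * M), g k * (6 * (2 * (k : ℝ) + 1) ^ 2) ≤ 96 * (r : ℝ) := by
    calc ∑ k ∈ Finset.Ico M (2 * M), g k * (6 * (2 * (k : ℝ) + 1) ^ 2)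
        ≤ ∑ _k ∈ Finset.Ico M (2 * M), 96 * (r : ℝ) / M := by
          refine Finset.sum_le_sum fun k hk => ?_
          rw [Finset.mem_Ico] at hk
          have hk2 : 2 * (k : ℝ) + 1 ≤ 4 * M := by
            have : (k : ℝ) + 1 ≤ 2 * M := by exact_mod_cast hk.2
            linarith
          have hk0 : 0 ≤ 2 * (k : ℝ) + 1 := by positivity
          calc g k * (6 * (2 * (k : ℝ) + 1) ^ 2) ≤ ((r : ℝ) / (M : ℝ) ^ 3) * (6 * (4 * (M : ℝ)) ^ 2) := by
                refine mul_le_mul (htapInc k hk.1 hk.2) ?_ (by positivity) (by positivity)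
                nlinarith [mul_self_le_mul_self hk0 hk2]
            _ = 96 * (r : ℝ) / M := by field_simp; ring
      _ = 96 * (r : ℝ) := by
          rw [Finset.sum_const, Nat.card_Ico, nsmul_eq_mul]
          have : ((2 * M - M : ℕ) : ℝ) = M := by
            rw [show 2 * M - M = M by omega]
          rw [this]
          field_simp
  calc ∑ b ∈ A, (f (N b.1) - f (N (b.1 + unitVec b.2))) ^ 2
      ≤ ∑ k ∈ Finset.range (2 * M), g k * (6 * (2 * (k : ℝ) + 1) ^ 2) := hstep2
    _ = _ := hsplit
    _ ≤ 0 + 6 * (r : ℝ) * (∑ k ∈ Finset.Ico r M, 1 / ((k : ℝ) + 1) + 2) + 96 * r := by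
        rw [hlow]; exact add_le_add (add_le_add le_rfl hmid) hhigh
    _ = 6 * (r : ℝ) * (∑ k ∈ Finset.Ico r M, 1 / ((k : ℝ) + 1) + 2) + 96 * r := by ring

/-! ## §2 Abel summation: the profile-weighted energy dominates the box energies on the log range -/

/-- Partial telescoping below a threshold: for a non-increasing, non-negative `f` and any `m`,
`Σ_{k ∈ [r,M), m ≤ k} (f(k)² − f(k+1)²) ≤ f(m)²`. [folklore] -/
theorem sum_ite_sq_sub_sq_le {f : ℕ → ℝ} (hf0 : ∀ n, 0 ≤ f n) (hanti : ∀ n, f (n + 1) ≤ f n) (r M m : ℕ) :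
    ∑ k ∈ Finset.Ico r M, (if m ≤ k then f k ^ 2 - f (k + 1) ^ 2 else 0) ≤ f m ^ 2 := by
  classical
  have hmono : Antitone f := antitone_nat_of_succ_le hanti
  by_cases hM : max r m ≤ M
  · rw [← Finset.sum_Ico_consecutive _ (le_max_left r m) hM]
    have h1 : ∑ k ∈ Finset.Ico r (max r m), (if m ≤ k then f k ^ 2 - f (k + 1) ^ 2 else 0) = 0 := by
      refine Finset.sum_eq_zero fun k hk => ?_
      rw [Finset.mem_Ico] at hk
      have : ¬ m ≤ k := by omega
      rw [if_neg this]
    have h2 : ∑ k ∈ Finset.Ico (max r m) M, (if m ≤ k then f k ^ 2 - f (k + 1) ^ 2 else 0) =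
        ∑ k ∈ Finset.Ico (max r m) M, (f k ^ 2 - f (k + 1) ^ 2) := by
      refine Finset.sum_congr rfl fun k hk => ?_
      rw [Finset.mem_Ico] at hk
      have : m ≤ k := le_trans (le_max_right r m) hk.1
      rw [if_pos this]
    have htel : ∑ k ∈ Finset.Ico (max r m) M, (f k ^ 2 - f (k + 1) ^ 2) = f (max r m) ^ 2 - f M ^ 2 := by
      have h := Finset.sum_Ico_sub (f := fun k : ℕ => -(f k ^ 2)) hM
      rw [show f (max r m) ^ 2 - f M ^ 2 = -(f M ^ 2) - -(f (max r m) ^ 2) by ring, ← h]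
      exact Finset.sum_congr rfl fun k _ => by ring
    rw [h1, h2, zero_add, htel]
    have h3 : f (max r m) ≤ f m := hmono (le_max_right r m)
    have h4 : f (max r m) ^ 2 ≤ f m ^ 2 := pow_le_pow_left₀ (hf0 _) h3 2
    nlinarith [sq_nonneg (f M)]
  · have h1 : ∑ k ∈ Finset.Ico r M, (if m ≤ k then f k ^ 2 - f (k + 1) ^ 2 else 0) = 0 := by
      refine Finset.sum_eq_zero fun k hk => ?_
      rw [Finset.mem_Ico] at hk
      have : ¬ m ≤ k := by omega
      rw [if_neg this]
    rw [h1]; exact sq_nonneg _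

/-- ★ **ABEL LOWER BOUND.**  For the shell index `N` of `Q_•(z)`, a non-increasing non-negative profile `f` with `f(k)² − f(k+1)² = r∕k − r∕(k+1)` on
`[r, M)`, and non-negative bond weights `e`, the profile-weighted sum dominates the box sums:
`Σ_{k∈[r,M)} (r∕k − r∕(k+1))·Σ_{b ∈ T, both ends in Q_k(z)} e_b ≤ Σ_{b∈T} f(N x)·f(N y)·e_b`. [folklore] -/
theorem sum_box_energy_le_sum_profile (T : Finset (Zd 3 × Fin 3)) (z : Zd 3) {N : Zd 3 → ℕ}
    (hN : ∀ (y : Zd 3) (k : ℕ), y ∈ box z (k : ℤ) ↔ N y ≤ k) {r M : ℕ} {f : ℕ → ℝ}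
    (hf0 : ∀ n, 0 ≤ f n) (hanti : ∀ n, f (n + 1) ≤ f n)
    (hsq : ∀ k, r ≤ k → k < M → f k ^ 2 - f (k + 1) ^ 2 = (r : ℝ) / k - (r : ℝ) / (k + 1))
    (e : Zd 3 × Fin 3 → ℝ) (he : ∀ b, 0 ≤ e b) :
    ∑ k ∈ Finset.Ico r M, ((r : ℝ) / k - (r : ℝ) / (k + 1)) *
        ∑ b ∈ T.filter (fun b => b.1 ∈ box z (k : ℤ) ∧ b.1 + unitVec b.2 ∈ box z (k : ℤ)), e b ≤
      ∑ b ∈ T, f (N b.1) * f (N (b.1 + unitVec b.2)) * e b := by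
  classical
  have hmono : Antitone f := antitone_nat_of_succ_le hanti
  -- pointwise: `f(N x) f(N y) ≥ f(max)² ≥ Σ_k (f k² − f(k+1)²)·[both ends in Q_k]`
  have hpt : ∀ b : Zd 3 × Fin 3,
      ∑ k ∈ Finset.Ico r M, (if (b.1 ∈ box z (k : ℤ) ∧ b.1 + unitVec b.2 ∈ box z (k : ℤ)) then
          ((r : ℝ) / k - (r : ℝ) / (k + 1)) else 0) ≤ f (N b.1) * f (N (b.1 + unitVec b.2)) := by
    intro b
    set m := max (N b.1) (N (b.1 + unitVec b.2)) with hm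
    have hiff : ∀ k : ℕ, (b.1 ∈ box z (k : ℤ) ∧ b.1 + unitVec b.2 ∈ box z (k : ℤ)) ↔ m ≤ k := by
      intro k; rw [hN, hN, hm, max_le_iff]
    have h1 : ∑ k ∈ Finset.Ico r M, (if (b.1 ∈ box z (k : ℤ) ∧ b.1 + unitVec b.2 ∈ box z (k : ℤ)) then
          ((r : ℝ) / k - (r : ℝ) / (k + 1)) else 0) =
        ∑ k ∈ Finset.Ico r M, (if m ≤ k then f k ^ 2 - f (k + 1) ^ 2 else 0) := by
      refine Finset.sum_congr rfl fun k hk => ?_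
      rw [Finset.mem_Ico] at hk
      simp only [hiff k, hsq k hk.1 hk.2]
    rw [h1]
    refine (sum_ite_sq_sub_sq_le hf0 hanti r M m).trans ?_
    rw [sq]
    exact mul_le_mul (hmono (le_max_left _ _)) (hmono (le_max_right _ _)) (hf0 _) (hf0 _)
  calc ∑ k ∈ Finset.Ico r M, ((r : ℝ) / k - (r : ℝ) / (k + 1)) *
        ∑ b ∈ T.filter (fun b => b.1 ∈ box z (k : ℤ) ∧ b.1 + unitVec b.2 ∈ box z (k : ℤ)), e b
      = ∑ k ∈ Finset.Ico r M, ∑ b ∈ T, (if (b.1 ∈ box z (k : ℤ) ∧ b.1 + unitVec b.2 ∈ box z (k : ℤ)) then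
          ((r : ℝ) / k - (r : ℝ) / (k + 1)) else 0) * e b := by
        refine Finset.sum_congr rfl fun k _ => ?_
        rw [Finset.mul_sum, Finset.sum_filter]
        refine Finset.sum_congr rfl fun b _ => ?_
        split_ifs <;> simp
    _ = ∑ b ∈ T, (∑ k ∈ Finset.Ico r M, (if (b.1 ∈ box z (k : ℤ) ∧ b.1 + unitVec b.2 ∈ box z (k : ℤ)) then
          ((r : ℝ) / k - (r : ℝ) / (k + 1)) else 0)) * e b := by
        rw [Finset.sum_comm]
        refine Finset.sum_congr rfl fun b _ => ?_
        rw [Finset.sum_mul]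
    _ ≤ ∑ b ∈ T, f (N b.1) * f (N (b.1 + unitVec b.2)) * e b :=
        Finset.sum_le_sum fun b _ => mul_le_mul_of_nonneg_right (hpt b) (he b)

/-! ## §3 The window letter and the closing arithmetic (harmonic ≥ log is lit ✓`log_div_le_sum_Ico_inv`) -/

/-- Window ⇒ harmonic mass: if `2e^{H₀}·r ≤ M` (`r ≥ 1`, `H₀ ≥ 0`) then `H₀ ≤ Σ_{k∈[r,M)} 1∕(k+1)`. [folklore] -/
theorem le_harmonic_of_window {r M : ℕ} {H₀ : ℝ} (hH₀ : 0 ≤ H₀) (hr : 1 ≤ r) (hM : 2 * Real.exp H₀ * r ≤ M) :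
    H₀ ≤ ∑ k ∈ Finset.Ico r M, 1 / ((k : ℝ) + 1) := by
  have hr0 : (1 : ℝ) ≤ r := by exact_mod_cast hr
  have hexp : 1 ≤ Real.exp H₀ := Real.one_le_exp hH₀
  have hrM : (r : ℝ) ≤ M := by nlinarith
  have hrM' : r ≤ M := by exact_mod_cast hrM
  refine le_trans ?_ (log_div_le_sum_Ico_inv hrM')
  have hq : Real.exp H₀ ≤ ((M : ℝ) + 1) / ((r : ℝ) + 1) := by
    rw [le_div_iff₀ (by positivity)]
    nlinarith
  calc H₀ = Real.log (Real.exp H₀) := (Real.log_exp H₀).symm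
    _ ≤ Real.log (((M : ℝ) + 1) / ((r : ℝ) + 1)) := Real.log_le_log (Real.exp_pos H₀) hq

/-- The closing arithmetic of the cap: `X > c·r·H`, `((c+18)∕c)·X ≤ G + W`, `G ≤ 36rH + 648r`, `W ≤ (2 + 8∕ε)r` force `H < (650 + 8∕ε)∕(c − 18)`. [folklore] -/
theorem cap_arith {c ε r H X G W : ℝ} (hc : 18 < c) (hε : 2 - ε / 2 = (c + 18) / c) (hr : 0 < r)
    (hX : c * r * H < X) (hmain : (2 - ε / 2) * X ≤ G + W) (hG : G ≤ 36 * r * H + 648 * r) (hW : W ≤ (2 + 8 / ε) * r) :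
    H < (650 + 8 / ε) / (c - 18) := by
  have hc0 : 0 < c := by linarith
  rw [hε] at hmain
  rw [lt_div_iff₀ (by linarith)]
  have h1 : (c + 18) / c * (c * r * H) < (c + 18) / c * X := mul_lt_mul_of_pos_left hX (by positivity)
  have h2 : (c + 18) / c * (c * r * H) = (c + 18) * r * H := by field_simp
  rw [h2] at h1
  have h3 : (c + 18) * r * H < 36 * r * H + 648 * r + (2 + 8 / ε) * r := by linarith
  have h4 : (c + 18) * H < 36 * H + 648 + (2 + 8 / ε) := by
    have := (div_lt_div_iff_of_pos_right hr).2 h3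
    have e1 : (c + 18) * r * H / r = (c + 18) * H := by field_simp
    have e2 : (36 * r * H + 648 * r + (2 + 8 / ε) * r) / r = 36 * H + 648 + (2 + 8 / ε) := by field_simp
    rw [e1, e2] at this
    exact this
  linarith

end Summit.QuantumFields.YangMills.Theorems.PoincareLipschitzLogCutoffCapacity
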